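/-
Copyright (c) 2026 the pub-hodgecm-mathlib formalisation cell (harness21).  Prover seat hodgecm-mathlib-LH4-p07 (g3), req620 Track A «(D-RAM) FOUR-FRAME» squad
(MS ROAD A, Stage B brick B7 (iv) «CORE-HANGING COUNT», FILE (D1): the FOOT `n₁ = n₂` — glue classes, κ-stability, the EMPTY regimes; Stage B lead LH4-p10 (g2)).  2026-09-04.
-/
import Summits.HodgeConjecture.HodgeConjecture.Theorems.F0P3cDyRamDiagonalCoreHangingOrbits        -- ★ p856021 (A) (this seat): `v_one_add_kappa_eq_one`, κ-criterion; brings ★ (iv-a), ★ B7 (i), ★ TorusDefs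
import Summits.HodgeConjecture.HodgeConjecture.Theorems.F0P3cDyRamDiagonalGluedStabiliserIndex   -- ★ p855926 (F0P3-p01 (g31)): `ne_zero_and_v_lt_one_of_v_eq_exp`
import Summits.HodgeConjecture.HodgeConjecture.Theorems.F0P3cDyRamDiagonalGlueShellCount         -- ★ p855870 B6 LH4-p10 (g2): `relIndex_ball_fixedBall_sup_ball`; brings ★ B5 (ii) `GluedStability`, ★ B1
import HarnessLib

/-!
# Crux `H413`, MS ROAD A, STAGE B brick B7 (iv), FILE (D1): the core-hanging stratum ON THE FOOT `n₁ = n₂ = m` — the GLUE CLASSES `q^{⌈ρ∕2⌉−⌈e∕2⌉}`, stability in `κ`-currency,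
# and the three EMPTY regimes (LH4-p10 (g2) MEMO v2 §4 (H); inputs of the glue summand of the B10 socket `stub_B7_H`)

Cell `hodgecm-mathlib` (D-0151), FLOOR 0, crux item H413 = `stmt-HodgeConjecture-24833`; lane `--supports stmt-HodgeConjecture-24833 --as helper` (count-neutral).  THEOREMS ONLY
(no `def`, no instance, no notation, no `sorry`, default heartbeats).  Stratum `𝒮_H(ρ)` as in ★ (C) `F0P3cDyRamDiagonalCoreHangingCount`.
THE MATHEMATICS.  At `s = 0` the three stability congruences (★ B5 (ii)) read `ρ ≤ n₃`, `ρ ≤ n₁`, and (S3) `|(β−1)xζ + (α−1)y″| ≤ |ϖ|^{2ρ}`.  Off the foot (`n₁ ≠ n₂`) (S3) is the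
tube condition, so below the tube the stratum is EMPTY (§3).  On the foot `n₁ = n₂ = m`: (S3) ⟺ `|κ + g₀| ≤ |ϖ|^{2ρ−m}`, `g₀ = (β−1)∕(α−1)`, `κ = y″∕(xζ)` (§2); for `m < 2ρ` this forces
`κ ≡ −g₀ (𝔭)`, and the unit letter `|1 + κ| = 1` then needs `|1 − g₀|·|ϖ|^m = |ϖ|^{n₃}` to be `|ϖ|^m`, i.e. `n₃ = m`: the glue lives only in the EQUILATERAL case (§3 empty otherwise;
also empty for `m < ρ` by (S1)).  §1 counts the glue classes among a complete irredundant system `R` of fixed units mod `𝔭^ρ`: they are `f₀ + ((𝒪_F ∩ 𝔭^e) mod (𝒪_F ∩ 𝔭^ρ))` for ANY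
fixed `f₀` with `|f₀ + g₀| ≤ |ϖ|^e` — `q^{⌈ρ∕2⌉−⌈e∕2⌉}` of them (★ B6 `relIndex_ball_fixedBall_sup_ball`) — and NONE without such an `f₀`.
* §1 `ncard_glue_representatives_eq`, `glue_representatives_eq_empty`.  §2 `mapGL_latt_coreHanging_eq_iff_kappa`, `v_one_sub_glueUnit`.
* §3 `coreHangingStratum_eq_empty_of_ne`, `coreHangingStratum_eq_empty_of_lt_rho`, `coreHangingStratum_eq_empty_of_ne₃`.
HONEST LABEL.  Count-neutral; `HC_CM` is proved only modulo the 7 printed citations (2 remaining named inputs: hLiu418 = `stmt-HodgeConjecture-24832`, h413 = `stmt-HodgeConjecture-24833`)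
until rung 0 closes.

## References
* [Kottwitz1986BaseChangeUnits] R. Kottwitz, *Base change for unit elements of Hecke algebras*, Compositio Math. 60 (1986), §1 pp. 240–241 (lattice counts via torus orbits).
* [Rogawski1990] J. D. Rogawski, *Automorphic Representations of Unitary Groups in Three Variables*, Ann. of Math. Stud. 123 (1990), §4.9 Prop. 4.9.1 (a) p. 55.
* [Serre1979] J.-P. Serre, *Local Fields*, GTM 67 (1979), Ch. IV §2 Prop. 6, Ch. I §6 Prop. 18 (fixed subring of a ramified quadratic extension; residue counts).
-/

set_option autoImplicit false

noncomputable section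

namespace Summit.HodgeConjecture.HodgeConjecture.Cruxes.H413.F0P3cDyRamDiagonalCoreHangingFoot

open Matrix WithZero
open Literature.NumberTheory.Automorphic Literature.NumberTheory.Automorphic.HermitianLattice
open Literature.NumberTheory.Automorphic.UnitaryLatticeTree
open Literature.NumberTheory.LocalFields.WildQuadraticDatum
open Summit.HodgeConjecture.HodgeConjecture.Cruxes.H413.F0P3cDyRamDiagonalTorusDefs
open Summit.HodgeConjecture.HodgeConjecture.Cruxes.H413.F0P3cDyRamDiagonalGluedTorusOrbits
open Summit.HodgeConjecture.HodgeConjecture.Cruxes.H413.F0P3cDyRamDiagonalCoreHangingOrbits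
open Summit.HodgeConjecture.HodgeConjecture.Cruxes.H413.F0P3cDyRamDiagonalGluedStabiliserIndex
open Summit.HodgeConjecture.HodgeConjecture.Cruxes.H413.F0P3cDyRamDiagonalGluedStability
open Summit.HodgeConjecture.HodgeConjecture.Cruxes.H413.F0P3cDyRamDiagonalGlueShellCount
open scoped Valued WithZero Matrix MatrixGroups

variable {K : Type*} [Field K] [Valued K ℤᵐ⁰]

/-! ## §1 The glue representatives: `f₀ + (𝒪_F ∩ 𝔭^e)` modulo `𝒪_F ∩ 𝔭^ρ` -/

/-- **THE GLUE CLASSES NUMBER `q^{⌈ρ∕2⌉−⌈e∕2⌉}`** once one exists: for the datum letters, `1 ≤ e ≤ ρ`, a unit `g₀`, a complete irredundant system `R` of `σ`-fixed units modulo `𝔭^ρ`,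
and a FIXED `f₀` with `|f₀ + g₀| ≤ |ϖ|^e`: `#{g ∈ R : |g + g₀| ≤ |ϖ|^e} = [(𝒪_F ∩ 𝔭^e) + 𝔭^ρ : 𝔭^ρ] = q^{⌈ρ∕2⌉−⌈e∕2⌉}` (bijection `g ↦ [g − f₀]`; ★ B6 `relIndex_ball_fixedBall_sup_ball`).
[cite: Serre1979, Ch. IV §2 Prop. 6; Ch. I §6 Prop. 18] [cite: Kottwitz1986BaseChangeUnits, §1 pp. 240–241] -/
theorem ncard_glue_representatives_eq {σ : K →+* K} {ϖ : K} {d : ℕ} (hσ : ∀ x, σ (σ x) = x) (hvσ : ∀ a, Valued.v (σ a) = Valued.v a)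
    (hfix : ∀ x : K, σ x = x → x ≠ 0 → ∃ n : ℤ, Valued.v x = exp (2 * n)) (hϖ : Valued.v ϖ = exp (-1 : ℤ))
    (hd : Valued.v (ϖ - σ ϖ) = Valued.v ϖ ^ d) [Finite 𝓀[K]] {ρ e : ℕ} (he1 : 1 ≤ e) (heρ : e ≤ ρ) {R : Set K} (hRfin : R.Finite)
    (hR1 : ∀ g ∈ R, σ g = g ∧ Valued.v g = 1) (hR2 : ∀ f : K, σ f = f → Valued.v f = 1 → ∃ g ∈ R, Valued.v (f - g) ≤ Valued.v ϖ ^ ρ)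
    (hR3 : ∀ g ∈ R, ∀ g' ∈ R, Valued.v (g - g') ≤ Valued.v ϖ ^ ρ → g = g') {g₀ : K} (hg₀ : Valued.v g₀ = 1)
    {f₀ : K} (hσf₀ : σ f₀ = f₀) (hf₀ : Valued.v (f₀ + g₀) ≤ Valued.v ϖ ^ e) :
    {g ∈ R | Valued.v (g + g₀) ≤ Valued.v ϖ ^ e}.ncard = Nat.card 𝓀[K] ^ ((ρ + 1) / 2 - (e + 1) / 2) := by
  classical
  have hϖe : Valued.v ϖ ^ e = exp (-(e : ℤ)) := v_varpi_pow hϖ e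
  have hϖρ : Valued.v ϖ ^ ρ = exp (-(ρ : ℤ)) := v_varpi_pow hϖ ρ
  have hϖe1 : Valued.v ϖ ^ e < 1 := by rw [hϖe, ← exp_zero, exp_lt_exp]; omega
  have hρe : Valued.v ϖ ^ ρ ≤ Valued.v ϖ ^ e := by rw [hϖe, hϖρ, exp_le_exp]; omega
  -- `|f₀| = 1`
  have hvf₀ : Valued.v f₀ = 1 := by
    have e1 : f₀ = (f₀ + g₀) + -g₀ := by ring
    rw [e1, Valuation.map_add_eq_of_lt_right _ (by rw [Valuation.map_neg, hg₀]; exact hf₀.trans_lt hϖe1), Valuation.map_neg, hg₀]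
  -- the subgroups
  set Fx : AddSubgroup K := (σ.toAddMonoidHom - AddMonoidHom.id K).ker with hFx
  set Be : AddSubgroup K := (Valued.v : Valuation K ℤᵐ⁰).leAddSubgroup (exp (-(e : ℤ))) with hBe
  set Bρ : AddSubgroup K := (Valued.v : Valuation K ℤᵐ⁰).leAddSubgroup (exp (-(ρ : ℤ))) with hBρ
  set H : AddSubgroup K := (Fx ⊓ Be) ⊔ Bρ with hH
  have hidx : Bρ.relIndex H = Nat.card 𝓀[K] ^ ((ρ + 1) / 2 - (e + 1) / 2) := relIndex_ball_fixedBall_sup_ball hσ hvσ hfix hϖ hd heρ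
  have hBρH : Bρ ≤ H := le_sup_right
  set Rg : Set K := {g ∈ R | Valued.v (g + g₀) ≤ Valued.v ϖ ^ e} with hRg
  -- `g − f₀ ∈ Fx ⊓ Be ≤ H` for `g ∈ Rg`
  have hmemH : ∀ g ∈ Rg, g - f₀ ∈ H := by
    rintro g ⟨hgR, hg⟩
    refine AddSubgroup.mem_sup_left (AddSubgroup.mem_inf.2 ⟨(mem_fixedSubgroup_iff _).2 (by rw [map_sub, (hR1 g hgR).1, hσf₀]), ?_⟩)
    rw [hBe, Valuation.mem_leAddSubgroup_iff, ← hϖe, show g - f₀ = (g + g₀) - (f₀ + g₀) by ring]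
    exact Valuation.map_sub_le _ hg hf₀
  let ψ : Rg → H ⧸ Bρ.addSubgroupOf H := fun g => QuotientAddGroup.mk ⟨(g : K) - f₀, hmemH g g.2⟩
  have hψ : Function.Bijective ψ := by
    constructor
    · intro g g' h
      apply Subtype.ext
      change (QuotientAddGroup.mk (⟨(g : K) - f₀, hmemH g g.2⟩ : H) : H ⧸ Bρ.addSubgroupOf H) = QuotientAddGroup.mk ⟨(g' : K) - f₀, hmemH g' g'.2⟩ at h
      rw [QuotientAddGroup.eq, AddSubgroup.mem_addSubgroupOf, hBρ] at h
      change -((g : K) - f₀) + ((g' : K) - f₀) ∈ (Valued.v : Valuation K ℤᵐ⁰).leAddSubgroup (exp (-(ρ : ℤ))) at h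
      rw [Valuation.mem_leAddSubgroup_iff, ← hϖρ, show -((g : K) - f₀) + ((g' : K) - f₀) = (g' : K) - g by ring, Valuation.map_sub_swap] at h
      exact hR3 _ g.2.1 _ g'.2.1 h
    · intro q
      induction q using QuotientAddGroup.induction_on with
      | H h =>
        obtain ⟨δ, hδ, b, hb, hδb⟩ := AddSubgroup.mem_sup.1 h.2
        obtain ⟨hδF, hδe⟩ := AddSubgroup.mem_inf.1 hδ
        rw [mem_fixedSubgroup_iff] at hδF
        rw [hBe, Valuation.mem_leAddSubgroup_iff, ← hϖe] at hδe
        rw [hBρ, Valuation.mem_leAddSubgroup_iff, ← hϖρ] at hb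
        -- the fixed unit `f₀ + δ` and its representative
        have hvf : Valued.v (f₀ + δ) = 1 := by rw [Valuation.map_add_eq_of_lt_left _ (by rw [hvf₀]; exact hδe.trans_lt hϖe1), hvf₀]
        obtain ⟨g, hgR, hfg⟩ := hR2 (f₀ + δ) (by rw [map_add, hσf₀, hδF]) hvf
        have hgRg : g ∈ Rg := by
          refine ⟨hgR, ?_⟩
          rw [show g + g₀ = -((f₀ + δ) - g) + δ + (f₀ + g₀) by ring]
          refine Valuation.map_add_le _ (Valuation.map_add_le _ ?_ hδe) hf₀
          rw [Valuation.map_neg]; exact hfg.trans hρe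
        refine ⟨⟨g, hgRg⟩, ?_⟩
        change (QuotientAddGroup.mk (⟨g - f₀, hmemH g hgRg⟩ : H) : H ⧸ Bρ.addSubgroupOf H) = QuotientAddGroup.mk h
        rw [QuotientAddGroup.eq, AddSubgroup.mem_addSubgroupOf, hBρ]
        change -(g - f₀) + (h : K) ∈ (Valued.v : Valuation K ℤᵐ⁰).leAddSubgroup (exp (-(ρ : ℤ)))
        rw [Valuation.mem_leAddSubgroup_iff, ← hϖρ, ← hδb, show -(g - f₀) + (δ + b) = ((f₀ + δ) - g) + b by ring]
        exact Valuation.map_add_le _ hfg hb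
  have hRgfin : Rg.Finite := hRfin.subset (Set.sep_subset _ _)
  haveI : Finite Rg := hRgfin.to_subtype
  rw [← Nat.card_coe_set_eq, Nat.card_congr (Equiv.ofBijective ψ hψ), ← AddSubgroup.index_eq_card]
  exact hidx

omit [Valued K ℤᵐ⁰] in
/-- … and there are NO glue classes if no fixed element is `𝔭^e`-close to `−g₀` (every representative is fixed). [cite: Kottwitz1986BaseChangeUnits, §1 pp. 240–241] -/
theorem glue_representatives_eq_empty [Valued K ℤᵐ⁰] {σ : K →+* K} {ϖ : K} {e : ℕ} {R : Set K} (hR1 : ∀ g ∈ R, σ g = g ∧ Valued.v g = 1) {g₀ : K}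
    (hno : ¬ ∃ f : K, σ f = f ∧ Valued.v (f + g₀) ≤ Valued.v ϖ ^ e) :
    {g ∈ R | Valued.v (g + g₀) ≤ Valued.v ϖ ^ e} = ∅ :=
  Set.eq_empty_of_forall_notMem fun g ⟨hgR, hg⟩ => hno ⟨g, (hR1 g hgR).1, hg⟩

/-! ## §2 Stability at `s = 0` in `κ`-currency on the foot `n₁ = n₂ = m` -/

/-- **STABILITY OF A CORE-HANGING LATTICE ON THE FOOT `|β−1| = |α−1| = |ϖ|^m`**: `T·latt V_H(x,ζ,y″) = latt V_H ⟺ ρ ≤ n₃ ∧ ρ ≤ m ∧ |κ + g₀| ≤ |ϖ|^{2ρ−m}` with `κ = y″∕(xζ)`,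
`g₀ = (β−1)∕(α−1)` (★ B5 (ii) at `s = 0`; `(β−1)xζ + (α−1)y″ = (α−1)·xζ·(g₀ + κ)`; for `2ρ ≤ m` the last clause is vacuous on both sides — ℕ-subtraction exact).
[cite: Kottwitz1986BaseChangeUnits, §1 pp. 240–241] [cite: Rogawski1990, §4.9 Prop. 4.9.1 (a) p. 55] -/
theorem mapGL_latt_coreHanging_eq_iff_kappa {ϖ : K} (hϖ : Valued.v ϖ = exp (-1 : ℤ)) {α β : K} (hα : Valued.v α = 1) (hβ : Valued.v β = 1)
    (T : GL (Fin 3) K) (hT : (T : Matrix (Fin 3) (Fin 3) K) = Matrix.diagonal ![α, β, 1]) {m n₃ : ℕ}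
    (h₁ : Valued.v (β - 1) = Valued.v ϖ ^ m) (h₂ : Valued.v (α - 1) = Valued.v ϖ ^ m) (h₃ : Valued.v (β - α) = Valued.v ϖ ^ n₃)
    (ρ : ℕ) {x ζ y'' : K} (hx : Valued.v x = 1) (hζ : Valued.v ζ = 1) (hy'' : Valued.v y'' = 1) (V : GL (Fin 3) K)
    (hV : (V : Matrix (Fin 3) (Fin 3) K) = !![1, 0, 0; x, ϖ ^ ρ, 0; x * ζ + y'', ϖ ^ ρ * ζ, ϖ ^ (2 * ρ)]) :
    mapGL T (latt (V : Matrix (Fin 3) (Fin 3) K)) = latt (V : Matrix (Fin 3) (Fin 3) K) ↔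
      ρ ≤ n₃ ∧ ρ ≤ m ∧ Valued.v (y'' / (x * ζ) + (β - 1) / (α - 1)) ≤ Valued.v ϖ ^ (2 * ρ - m) := by
  obtain ⟨hϖ0, hϖ1⟩ := ne_zero_and_v_lt_one_of_v_eq_exp hϖ
  have hvϖ : 0 < Valued.v ϖ := (Valuation.pos_iff _).2 hϖ0
  have hV0 : (V : Matrix (Fin 3) (Fin 3) K) = !![1, 0, 0; x, ϖ ^ ρ, 0; x * ζ + y'', ϖ ^ ρ * ζ, ϖ ^ (2 * ρ + 0)] := by rw [Nat.add_zero]; exact hV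
  rw [mapGL_latt_hnf_glued_eq_iff hϖ0 hα hβ T hT ρ 0 x ζ y'' V hV0, Nat.add_zero, Nat.add_zero]
  have hx0 : x ≠ 0 := fun h0 => by rw [h0, map_zero] at hx; exact zero_ne_one hx
  have hζ0 : ζ ≠ 0 := fun h0 => by rw [h0, map_zero] at hζ; exact zero_ne_one hζ
  have hα1 : α - 1 ≠ 0 := fun h0 => by rw [h0, map_zero] at h₂; exact pow_ne_zero _ hvϖ.ne' h₂.symm
  have hle : ∀ {a b : ℕ}, Valued.v ϖ ^ a ≤ Valued.v ϖ ^ b ↔ b ≤ a := fun {a b} => by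
    rw [v_varpi_pow hϖ, v_varpi_pow hϖ, exp_le_exp]; omega
  -- (S2) and (S1)
  have e2 : Valued.v ((β - α) * x) ≤ Valued.v ϖ ^ ρ ↔ ρ ≤ n₃ := by rw [map_mul, hx, mul_one, h₃, hle]
  have e1 : Valued.v ((β - 1) * ζ) ≤ Valued.v ϖ ^ ρ ↔ ρ ≤ m := by rw [map_mul, hζ, mul_one, h₁, hle]
  -- (S3): `(β−1)xζ + (α−1)y″ = (α−1)·(xζ)·(g₀ + κ)`
  have e3' : (β - 1) * x * ζ + (α - 1) * y'' = (α - 1) * (x * ζ) * (y'' / (x * ζ) + (β - 1) / (α - 1)) := by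
    field_simp
    ring
  have e3 : Valued.v ((β - 1) * x * ζ + (α - 1) * y'') ≤ Valued.v ϖ ^ (2 * ρ) ↔
      Valued.v (y'' / (x * ζ) + (β - 1) / (α - 1)) ≤ Valued.v ϖ ^ (2 * ρ - m) := by
    rw [e3', map_mul, map_mul, map_mul, h₂, hx, hζ, mul_one, mul_one]
    rcases le_or_gt m (2 * ρ) with hm | hm
    · rw [show 2 * ρ = m + (2 * ρ - m) by omega, pow_add, show m + (2 * ρ - m) - m = 2 * ρ - m by omega]
      exact mul_le_mul_iff_of_pos_left (pow_pos hvϖ _)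
    · -- both sides hold: `|κ + g₀| ≤ 1`
      have hκg : Valued.v (y'' / (x * ζ) + (β - 1) / (α - 1)) ≤ 1 := by
        refine Valuation.map_add_le _ ?_ ?_
        · rw [map_div₀, map_mul, hx, hζ, mul_one, hy'', div_one]
        · rw [map_div₀, h₁, h₂, div_self (pow_ne_zero _ hvϖ.ne')]
      rw [show 2 * ρ - m = 0 by omega, pow_zero]
      refine ⟨fun _ => hκg, fun _ => ?_⟩
      calc Valued.v ϖ ^ m * Valued.v (y'' / (x * ζ) + (β - 1) / (α - 1)) ≤ Valued.v ϖ ^ m * 1 := mul_le_mul_right hκg _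
        _ = Valued.v ϖ ^ m := mul_one _
        _ ≤ Valued.v ϖ ^ (2 * ρ) := hle.2 hm.le
  rw [e2, e1, e3]

/-- On the foot `n₁ = n₂ = m`, `|1 − g₀| = |ϖ|^{n₃−m}` … precisely `|1 − g₀|·|ϖ|^m = |ϖ|^{n₃}` (`1 − g₀ = (α − β)∕(α − 1)`). [cite: Rogawski1990, §4.9 Prop. 4.9.1 (a) p. 55] -/
theorem v_one_sub_glueUnit {ϖ : K} (hϖ : Valued.v ϖ = exp (-1 : ℤ)) {α β : K} {m n₃ : ℕ}
    (h₂ : Valued.v (α - 1) = Valued.v ϖ ^ m) (h₃ : Valued.v (β - α) = Valued.v ϖ ^ n₃) :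
    Valued.v (1 - (β - 1) / (α - 1)) * Valued.v ϖ ^ m = Valued.v ϖ ^ n₃ := by
  obtain ⟨hϖ0, -⟩ := ne_zero_and_v_lt_one_of_v_eq_exp hϖ
  have hvϖ : 0 < Valued.v ϖ := (Valuation.pos_iff _).2 hϖ0
  have hα1 : α - 1 ≠ 0 := fun h0 => by rw [h0, map_zero] at h₂; exact pow_ne_zero _ hvϖ.ne' h₂.symm
  have e : 1 - (β - 1) / (α - 1) = -(β - α) / (α - 1) := by field_simp; ring
  rw [e, map_div₀, Valuation.map_neg, h₃, h₂, div_mul_cancel₀ _ (pow_ne_zero _ hvϖ.ne')]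

/-! ## §3 The EMPTY regimes -/

/-- **BELOW THE TUBE, OFF THE FOOT, THE STRATUM IS EMPTY**: `n₁ ≠ n₂` and `¬(2ρ ≤ n₁ ∧ 2ρ ≤ n₂)` ⇒ no core-hanging lattice is `T`-stable (★ B5 (ii) `depths_of_mapGL_latt_hnf_glued_eq`
at `s = 0`). [cite: Kottwitz1986BaseChangeUnits, §1 pp. 240–241] -/
theorem coreHangingStratum_eq_empty_of_ne (σ : K →+* K) {ϖ : K} (hϖ : Valued.v ϖ = exp (-1 : ℤ))
    (T : GL (Fin 3) K) {α β : K} (hT : (T : Matrix (Fin 3) (Fin 3) K) = Matrix.diagonal ![α, β, 1]) (hα : Valued.v α = 1) (hβ : Valued.v β = 1)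
    {n₁ n₂ : ℕ} (h₁ : Valued.v (β - 1) = Valued.v ϖ ^ n₁) (h₂ : Valued.v (α - 1) = Valued.v ϖ ^ n₂) (hne : n₁ ≠ n₂)
    {ρ : ℕ} (hlow : ¬ (2 * ρ ≤ n₁ ∧ 2 * ρ ≤ n₂)) :
    {M : Submodule 𝒪[K] (Fin 3 → K) | M ∈ normalisedStableLattices T ∧ IsDualisableLattice σ ϖ M ∧
        ∃ x ζ y'' : K, Valued.v x = 1 ∧ Valued.v ζ = 1 ∧ Valued.v y'' = 1 ∧ Valued.v (x * ζ + y'') = 1 ∧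
          M = latt (!![1, 0, 0; x, ϖ ^ ρ, 0; x * ζ + y'', ϖ ^ ρ * ζ, ϖ ^ (2 * ρ)] : Matrix (Fin 3) (Fin 3) K)} = ∅ := by
  obtain ⟨hϖ0, hϖ1⟩ := ne_zero_and_v_lt_one_of_v_eq_exp hϖ
  refine Set.eq_empty_of_forall_notMem fun M ⟨⟨_, hTM, _⟩, _, x, ζ, y'', hx, hζ, hy'', _, hM⟩ => ?_
  obtain ⟨V, hV⟩ := exists_gl_coe_eq_glued x ζ y'' (pow_ne_zero ρ hϖ0) (pow_ne_zero (2 * ρ) hϖ0)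
  have hV0 : (V : Matrix (Fin 3) (Fin 3) K) = !![1, 0, 0; x, ϖ ^ ρ, 0; x * ζ + y'', ϖ ^ ρ * ζ, ϖ ^ (2 * ρ + 0)] := by rw [Nat.add_zero]; exact hV
  rw [hM, ← hV] at hTM
  have h := depths_of_mapGL_latt_hnf_glued_eq hϖ0 hϖ1 hα hβ T hT h₁ h₂ ρ 0 (by rwa [Nat.add_zero]) hx hζ (by rw [pow_zero]; exact hy'') V hV0 hTM
  exact hlow ⟨by omega, h.2⟩

/-- **ON THE FOOT BELOW HEIGHT `ρ` THE STRATUM IS EMPTY**: `n₁ = n₂ = m < ρ` ⇒ (S1) fails. [cite: Kottwitz1986BaseChangeUnits, §1 pp. 240–241] -/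
theorem coreHangingStratum_eq_empty_of_lt_rho (σ : K →+* K) {ϖ : K} (hϖ : Valued.v ϖ = exp (-1 : ℤ))
    (T : GL (Fin 3) K) {α β : K} (hT : (T : Matrix (Fin 3) (Fin 3) K) = Matrix.diagonal ![α, β, 1]) (hα : Valued.v α = 1) (hβ : Valued.v β = 1)
    {m n₃ : ℕ} (h₁ : Valued.v (β - 1) = Valued.v ϖ ^ m) (h₂ : Valued.v (α - 1) = Valued.v ϖ ^ m) (h₃ : Valued.v (β - α) = Valued.v ϖ ^ n₃)
    {ρ : ℕ} (hlow : m < ρ) :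
    {M : Submodule 𝒪[K] (Fin 3 → K) | M ∈ normalisedStableLattices T ∧ IsDualisableLattice σ ϖ M ∧
        ∃ x ζ y'' : K, Valued.v x = 1 ∧ Valued.v ζ = 1 ∧ Valued.v y'' = 1 ∧ Valued.v (x * ζ + y'') = 1 ∧
          M = latt (!![1, 0, 0; x, ϖ ^ ρ, 0; x * ζ + y'', ϖ ^ ρ * ζ, ϖ ^ (2 * ρ)] : Matrix (Fin 3) (Fin 3) K)} = ∅ := by
  obtain ⟨hϖ0, -⟩ := ne_zero_and_v_lt_one_of_v_eq_exp hϖ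
  refine Set.eq_empty_of_forall_notMem fun M ⟨⟨_, hTM, _⟩, _, x, ζ, y'', hx, hζ, hy'', _, hM⟩ => ?_
  obtain ⟨V, hV⟩ := exists_gl_coe_eq_glued x ζ y'' (pow_ne_zero ρ hϖ0) (pow_ne_zero (2 * ρ) hϖ0)
  rw [hM, ← hV] at hTM
  obtain ⟨-, hρm, -⟩ := (mapGL_latt_coreHanging_eq_iff_kappa hϖ hα hβ T hT h₁ h₂ h₃ ρ hx hζ hy'' V hV).1 hTM
  omega

/-- **ON THE FOOT, BELOW THE TUBE, OFF THE EQUILATERAL CASE THE STRATUM IS EMPTY**: `n₁ = n₂ = m < 2ρ`, `n₃ ≠ m` ⇒ stability forces `κ ≡ −g₀ (𝔭)` while `|1 − g₀| < 1`, so `|1 + κ| < 1`,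
contradicting the unit letter `|xζ + y″| = 1`. [cite: Kottwitz1986BaseChangeUnits, §1 pp. 240–241] [cite: Rogawski1990, §4.9 Prop. 4.9.1 (a) p. 55] -/
theorem coreHangingStratum_eq_empty_of_ne₃ (σ : K →+* K) {ϖ : K} (hϖ : Valued.v ϖ = exp (-1 : ℤ))
    (T : GL (Fin 3) K) {α β : K} (hT : (T : Matrix (Fin 3) (Fin 3) K) = Matrix.diagonal ![α, β, 1]) (hα : Valued.v α = 1) (hβ : Valued.v β = 1)
    {m n₃ : ℕ} (h₁ : Valued.v (β - 1) = Valued.v ϖ ^ m) (h₂ : Valued.v (α - 1) = Valued.v ϖ ^ m) (h₃ : Valued.v (β - α) = Valued.v ϖ ^ n₃)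
    {ρ : ℕ} (hm : m < 2 * ρ) (hn₃ : n₃ ≠ m) :
    {M : Submodule 𝒪[K] (Fin 3 → K) | M ∈ normalisedStableLattices T ∧ IsDualisableLattice σ ϖ M ∧
        ∃ x ζ y'' : K, Valued.v x = 1 ∧ Valued.v ζ = 1 ∧ Valued.v y'' = 1 ∧ Valued.v (x * ζ + y'') = 1 ∧
          M = latt (!![1, 0, 0; x, ϖ ^ ρ, 0; x * ζ + y'', ϖ ^ ρ * ζ, ϖ ^ (2 * ρ)] : Matrix (Fin 3) (Fin 3) K)} = ∅ := by
  obtain ⟨hϖ0, hϖ1⟩ := ne_zero_and_v_lt_one_of_v_eq_exp hϖ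
  have hvϖ : 0 < Valued.v ϖ := (Valuation.pos_iff _).2 hϖ0
  refine Set.eq_empty_of_forall_notMem fun M ⟨⟨_, hTM, _⟩, _, x, ζ, y'', hx, hζ, hy'', hy, hM⟩ => ?_
  obtain ⟨V, hV⟩ := exists_gl_coe_eq_glued x ζ y'' (pow_ne_zero ρ hϖ0) (pow_ne_zero (2 * ρ) hϖ0)
  rw [hM, ← hV] at hTM
  obtain ⟨hρ₃, -, hS3⟩ := (mapGL_latt_coreHanging_eq_iff_kappa hϖ hα hβ T hT h₁ h₂ h₃ ρ hx hζ hy'' V hV).1 hTM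
  -- `|κ + g₀| < 1` and `|1 − g₀| < 1`, so `|1 + κ| < 1`
  have hκg : Valued.v (y'' / (x * ζ) + (β - 1) / (α - 1)) < 1 :=
    hS3.trans_lt (pow_lt_one₀ zero_le hϖ1 (by omega))
  -- `n₃ ≥ m` from the isoceles inequality is not needed: `|1 − g₀|·|ϖ|^m = |ϖ|^{n₃}` and `n₃ ≠ m`
  have h1g : Valued.v (1 - (β - 1) / (α - 1)) < 1 := by
    have h := v_one_sub_glueUnit hϖ h₂ h₃
    by_contra hge
    rw [not_lt] at hge
    -- `|1 − g₀| ≤ 1` always? not needed: compare exponents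
    have hle1 : Valued.v (1 - (β - 1) / (α - 1)) ≤ 1 := by
      refine Valuation.map_sub_le _ (by rw [map_one]) ?_
      have hα1 : α - 1 ≠ 0 := fun h0 => by rw [h0, map_zero] at h₂; exact pow_ne_zero _ hvϖ.ne' h₂.symm
      rw [map_div₀, h₁, h₂, div_self (pow_ne_zero _ hvϖ.ne')]
    have heq : Valued.v (1 - (β - 1) / (α - 1)) = 1 := le_antisymm hle1 hge
    rw [heq, one_mul] at h
    exact hn₃ (pow_right_injective₀ hvϖ hϖ1.ne h).symm
  have h1κ : Valued.v (1 + y'' / (x * ζ)) < 1 := by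
    rw [show 1 + y'' / (x * ζ) = (1 - (β - 1) / (α - 1)) + (y'' / (x * ζ) + (β - 1) / (α - 1)) by ring]
    exact (Valuation.map_add _ _ _).trans_lt (max_lt h1g hκg)
  exact absurd (v_one_add_kappa_eq_one hx hζ hy) h1κ.ne


end Summit.HodgeConjecture.HodgeConjecture.Cruxes.H413.F0P3cDyRamDiagonalCoreHangingFoot

end
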